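import Literature.MathematicalPhysics.QuantumFieldTheory.Balaban1983to89.B9Eq315QknitSizesRecordY
import Literature.MathematicalPhysics.QuantumFieldTheory.Balaban1983to89.B9Eq3115KnitLetterYOnto

/-!
# `Balaban1983to89.B9Eq3115KnitLetterYRealReg335` — T. Bałaban, *Propagators for lattice gauge theories in a background field*, Commun. Math. Phys. **99**
# (1985) 389–434 [Balaban1985BackgroundPropagators], p. 391 («hermitian matrices»), (3.12)–(3.15) pp. 392–393, (3.35) p. 396: THE KNIT LETTER `Q(U)` IS REAL
# ON THE CLASS (3.35) — law (L4) of node00-def-Y's `QLawsY` for print's letter on the regime of record, and THE WHOLE LAW BUNDLE (L1)–(L8) there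

statement-level skeleton of published theorems with citation tags; proofs where landed; nothing here is a claim about the Yang–Mills mass gap

THE PRINT.  p. 391: the fields are hermitian (`𝔤`-valued) matrices; (3.12)–(3.15) pp. 392–393: `Q(U)` averages parallel transports, so it maps hermitian bond
functions to hermitian ones; (3.115) p. 418 + [5] = Bałaban, *Averaging operations for lattice gauge theories*, CMP **98** (1985), (22)–(23) p. 21, (127) p. 37:
the linearised composite averaging at a background in the regime (52) is real (it is the derivative of a group-valued map); (3.35) p. 396: the member's class.

WHY THIS FILE (cell `pub-ymgap`, node N06, seat `dag-n06-l` = bundle F7 rows 20–21, gen 36; director-ym №375 «R2-A»).  def-Y's `Node00/OpsYQLetter` types the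
law bundle `QLawsY 𝓡 D 𝔮 𝔮⋆ parS K` of an averaging letter; for the knit letter `QknitY` every law is in the tree ON THE REGIME OF RECORD `regQY G i c₀ α₀`
(= the class (3.35), `Node00.regQY`) — (L1) `isFlatQ_QknitY`, (L2) `isLocalQ_univ`, (L3) `isAdjOnQ_adjTrY`, (L5) `isCovCornerQ_QknitY`, (L6) this lineage's
`QknitY_surjective_of_reg335P`, (L7) dag-n06-c's `isBddOnQ_QknitY_reg335`, (L8) `isNullOnQ_QknitY_reg335` — EXCEPT (L4) reality, typed so far only in the
(52)-currency `pdev U♯ < α₀L^{−2k}` (`isRealOnQ_QknitY_pdev`), which a multi-level member of (3.35) does not satisfy.  THIS FILE moves (L4) to (3.35) by the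
retraction device of `B9Eq3124HZKnitPairReg335Y` ∕ `B9Eq315QknitSizesY` (row `ι` of `Q(U)` reads the retraction `Û_ι` of `U♯` to the double box, which IS
`α₀′L^{−2j(ι)}`-regular everywhere by [5] Prop. 2), and assembles the bundle.

WHAT IS PROVED (sorry-free; 0 `def`).
* §1 ★★ `QknitY_isRealOpY_of_reg335P` — `IsRealOpY (QknitY i U)` for every `U ∈ (bg9KP … G i).Reg335 c₀ α₀`, `G ≤ U(N)`, `c₀ ≤ 10`, `0 ≤ Mα₀`, x-free numerics
  `0 < α₀′`, `C₀α₀′ ≤ 1∕3`, `4α₀′ ≤ c₂′`, `e^{3200((d+1)+1)²((d+1)+4)α₀′} < 2`, `K_pl(Mα₀)·L⁴ < α₀′` (the binders of dag-n06-c's (L7)).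
* §2 def-Y's law shapes: ★★ `isRealOnQ_QknitY_reg335` ((L4) on `regQY`), `isRealOnQs_adjTrY_QknitY_reg335` ((L4*) for the generic adjoint),
  `isOntoOnQ_QknitY_reg335` ((L6) on `regQY`, this lineage's F8 by name).
* §3 ★★★ `qLawsY_QknitY_reg335` — `QLawsY (regQY G i c₀ α₀) (fun _ ↦ univ) (QknitY i) (adjTrY ∘ QknitY i) (parKnitY i) 2`: ALL EIGHT LAWS for print's letter on
  the regime of record, from `G ≤ U(N)`, `c₀ ≤ 10`, `0 ≤ Mα₀` and the x-free numerics `0 < α₀′ ≤ α_Q(d+1,L)`, `e^{…α₀′} < 2`, `K_pl(Mα₀)·L⁴ < α₀′`, `K(d+1,L)·α₀′ < 1`;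
  `qLawsY_qKnitOfRecord` (the same at def-Y's family of record `qKnitOfRecord N θ i`, `qsOfQFamY`-free form).
HONEST SCOPE.  (L4) on (3.35) is the only new estimate-free argument (a per-row reading of g34's `star_linCovIterC_eq_neg` at the retraction); §3 is bookkeeping over
landed laws by name; helper, count-neutral; N06 NOT discharged; nothing continuum ∕ OS ∕ mass gap ∕ Clay — the Yang–Mills mass gap is NOT proved here.
No `sorry`, no `axiom`, no `instance`, no `notation`, no `def`.
-/

noncomputable section

namespace Literature.MathematicalPhysics.QuantumFieldTheory.Balaban1983to89.B9Eq3115KnitLetterYRealReg335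

open scoped BigOperators Matrix Matrix.Norms.L2Operator
open B7Prop1Explicit renaming Site → LSite
open B7Prop2Explicit (pdev avgClosed_unitaryUnits unitaryUnits unitaryUnits_le_U1 C0 c2')
open B7Prop3Flat (c3)
open B7Prop4LinCovIterClosedLaws (linCovIterC_congr star_linCovIterC_eq_neg)
open B9Eq316AveragingTransposeZd (alphaQ four_mul_alphaQ_le)
open B9B8KnitColumnFlatness (windows_of_alphaQ)
open B6KLevelCensusIndexV1 (KIdx kGeo)
open B9B8KnitBondTransfer (liftBd liftBd_apply)
open B9Eq3115KnitLetterY (zSrc QknitY QknitY_apply liftBd_smul norm_liftBd_le lvl_le')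
open B9Eq3115KnitLetterYLaws (isRealOpY_of_skew)
open B9Eq3115KnitLetterYOnto (kCol retrY agreeOn_liftCfg_retrY retrY_mem QknitY_surjective_of_reg335P)
open B9Eq3124HZKnitPairReg335Y (pdev_retract_bond_lt)
open B9Eq315QknitSizesRecordY (isBddOnQ_QknitY_reg335)
open B9C2FormBoxRegimeY (Kpl)
open B9BackgroundsKLevelV1P (bg9KP mem_of_reg335P)
open Node00 Node00.OpsYQLetter
open B9B8AveragingJunction (parKnitY)

variable {d ℓ : ℕ} {hd : 1 ≤ d + 1} {hL : Odd (ℓ + 1) ∧ 1 < ℓ + 1} {b₀ b₁ : ℝ} {N : ℕ} [Nonempty (Fin N)]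
variable (i : KIdx d ℓ hd hL b₀ b₁) {G : Subgroup (Matrix (Fin N) (Fin N) ℂ)ˣ}

/-! ## §1 ★★ (L4) on the class (3.35) -/

/-- ★★ **(L4) REALITY OF `QknitY` ON THE MEMBER's CLASS (3.35)**: for `G ≤ U(N)`, `c₀ ≤ 10`, `0 ≤ Mα₀`, every `U ∈ (bg9KP …).Reg335 c₀ α₀` and x-free numerics
`0 < α₀′`, `C₀α₀′ ≤ 1∕3`, `4α₀′ ≤ c₂′`, `e^{3200((d+1)+1)²((d+1)+4)α₀′} < 2`, `K_pl(Mα₀)·L⁴ < α₀′`, the letter is real: `Q(U)(a⋆) = (Q(U)a)⋆`.  Row `ι` of `Q(U)a`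
reads the retraction `Û_ι` (locality `linCovIterC_congr`), which is unitary and `α₀′L^{−2j(ι)}`-regular EVERYWHERE ([5] Prop. 2, `pdev_retract_bond_lt`); there
g34's `star_linCovIterC_eq_neg` (skew fields go to skew fields, after a real rescaling small enough for its field-size binders at scale `Lᵏ ≥ L^{j(ι)}`) applies;
`isRealOpY_of_skew`. [cite: Balaban1985BackgroundPropagators, p.391 («hermitian matrices»), (3.12)–(3.15) p.393, (3.35) p.396; Balaban1985Averaging, (22)–(23) p.21, (127) p.37, Prop. 2 p.26] -/
theorem QknitY_isRealOpY_of_reg335P (hGU : G ≤ unitaryUnits (Matrix (Fin N) (Fin N) ℂ))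
    {U : CfgY (Matrix (Fin N) (Fin N) ℂ) i} {c₀ α₀ : ℝ} (hc : c₀ ≤ 10) (hMα : 0 ≤ (kGeo i).M * α₀)
    (hreg : (bg9KP (Matrix (Fin N) (Fin N) ℂ) G i).Reg335 c₀ α₀ U) {α₀' : ℝ} (hα' : 0 < α₀')
    (hα3 : C0 (d + 1) * α₀' ≤ 1 / 3) (hα4 : 4 * α₀' ≤ c2' (d + 1) (ℓ + 1))
    (hexp : Real.exp (4 * (800 * (((d + 1 : ℕ) : ℝ) + 1) ^ 2 * (((d + 1 : ℕ) : ℝ) + 4)) * α₀') < 2)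
    (hK : Kpl i ((kGeo i).M * α₀) * (kGeo i).L ^ 4 < α₀') :
    IsRealOpY (QknitY i U) := by
  letI : CStarAlgebra (Matrix (Fin N) (Fin N) ℂ) := {}
  have hL1 : 1 ≤ ℓ + 1 := Nat.succ_pos ℓ
  have hL2 : 2 ≤ ℓ + 1 := hL.2
  have hG1 : ∀ u : (Matrix (Fin N) (Fin N) ℂ)ˣ, u ∈ G → ‖(u : Matrix (Fin N) (Fin N) ℂ)‖ ≤ 1 :=
    fun u hu => (B7Prop1Explicit.mem_U1.1 (unitaryUnits_le_U1 (hGU hu))).1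
  have hU : ∀ μ x, U μ x ∈ unitaryUnits (Matrix (Fin N) (Fin N) ℂ) := fun μ x => hGU (mem_of_reg335P (G := G) i hreg μ x)
  refine isRealOpY_of_skew (QknitY i U) fun s hs => ?_
  -- sizes: the bound `b` of the skew field, g34's constants `E`, `K`, `Lᵏ`, and a real scale `ε` with `ε·b` below both thresholds at the TOP scale
  set b : ℝ := ∑ f : FBondY i, ‖s f‖ with hb
  have hb0 : 0 ≤ b := Finset.sum_nonneg fun f _ => norm_nonneg (s f)
  set E : ℝ := Real.exp (4 * (800 * (((d + 1 : ℕ) : ℝ) + 1) ^ 2 * (((d + 1 : ℕ) : ℝ) + 4)) * α₀') with hE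
  have hE0 : 0 < E := Real.exp_pos _
  set K : ℝ := 8 * (131072 * (((d + 1 : ℕ) : ℝ) + 1) ^ 2) with hK'
  have hK0 : 0 < K := by positivity
  set Lk : ℝ := (((ℓ + 1 : ℕ) : ℝ)) ^ i.k with hLk
  have hLk0 : 0 < Lk := by positivity
  have hc3 : 0 < c3 (d + 1) (ℓ + 1) := by rw [c3]; positivity
  set M : ℝ := min ((2 - E) / (E * K * Lk)) (c3 (d + 1) (ℓ + 1) / (2 * Lk)) with hM
  have hM0 : 0 < M := lt_min (div_pos (by linarith) (by positivity)) (div_pos hc3 (by positivity))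
  have hb1 : 0 < b + 1 := by linarith
  set ε : ℝ := M / (b + 1) with hε
  have hε0 : 0 < ε := div_pos hM0 hb1
  have hεb : ε * b ≤ M := by
    rw [hε, div_mul_eq_mul_div, div_le_iff₀ hb1]
    nlinarith
  have hεb0 : 0 ≤ ε * b := mul_nonneg hε0.le hb0
  have hsmall : E * (1 + K * (Lk * (ε * b))) ≤ 2 := by
    have h1 : ε * b ≤ (2 - E) / (E * K * Lk) := hεb.trans (min_le_left _ _)
    have h2 : E * K * Lk * (ε * b) ≤ 2 - E := by
      have := mul_le_mul_of_nonneg_left h1 (by positivity : 0 ≤ E * K * Lk)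
      rwa [mul_div_cancel₀ _ (by positivity : E * K * Lk ≠ 0)] at this
    nlinarith
  have hc₃ : 2 * (Lk * (ε * b)) ≤ c3 (d + 1) (ℓ + 1) := by
    have h1 : ε * b ≤ c3 (d + 1) (ℓ + 1) / (2 * Lk) := hεb.trans (min_le_right _ _)
    have h2 := mul_le_mul_of_nonneg_left h1 (by positivity : 0 ≤ 2 * Lk)
    rw [mul_div_cancel₀ _ (by positivity : 2 * Lk ≠ 0)] at h2
    calc 2 * (Lk * (ε * b)) = 2 * Lk * (ε * b) := by ring
      _ ≤ c3 (d + 1) (ℓ + 1) := h2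
  -- the rescaled lifted field is skew and bounded by `ε·b`
  have hBs : ∀ x κ, star (liftBd i (((ε : ℝ) : ℂ) • s) x κ) = -liftBd i (((ε : ℝ) : ℂ) • s) x κ := fun x κ => by
    rw [liftBd_apply, Pi.smul_apply, star_smul, Complex.star_def, Complex.conj_ofReal, ← smul_neg]
    congr 1
    exact congrFun hs _
  have hB : ∀ x κ, ‖liftBd i (((ε : ℝ) : ℂ) • s) x κ‖ ≤ ε * b := fun x κ => by
    rw [liftBd_smul, Pi.smul_apply, Pi.smul_apply, norm_smul, Complex.norm_real, Real.norm_of_nonneg hε0.le]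
    exact mul_le_mul_of_nonneg_left (norm_liftBd_le i s x κ) hε0.le
  -- reality of the composite at the RETRACTION of each row, at the rescaled field
  have hstar : ∀ ι : IBondY i, star (QknitY i U (((ε : ℝ) : ℂ) • s) ι) = -QknitY i U (((ε : ℝ) : ℂ) • s) ι := fun ι => by
    have hVu : ∀ x μ, retrY i U ι x μ ∈ unitaryUnits (Matrix (Fin N) (Fin N) ℂ) := retrY_mem i hU ι
    have h52 : pdev (retrY i U ι) < α₀' * ((((ℓ + 1 : ℕ) : ℝ) ^ (ι.1.1 : ℕ))⁻¹) ^ 2 := pdev_retract_bond_lt i hG1 U hc hMα hreg hK ι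
    -- the field-size binders at scale `L^{j(ι)} ≤ Lᵏ`
    set Lj : ℝ := (((ℓ + 1 : ℕ) : ℝ)) ^ (ι.1.1 : ℕ) with hLj
    have hLjk : Lj ≤ Lk := pow_le_pow_right₀ (by exact_mod_cast hL1) (lvl_le' i ι)
    have hsmall_j : E * (1 + K * (Lj * (ε * b))) ≤ 2 := by
      refine le_trans ?_ hsmall
      have : Lj * (ε * b) ≤ Lk * (ε * b) := mul_le_mul_of_nonneg_right hLjk hεb0
      have : K * (Lj * (ε * b)) ≤ K * (Lk * (ε * b)) := mul_le_mul_of_nonneg_left this hK0.le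
      nlinarith
    have hc₃_j : 2 * (Lj * (ε * b)) ≤ c3 (d + 1) (ℓ + 1) :=
      le_trans (by nlinarith [mul_le_mul_of_nonneg_right hLjk hεb0]) hc₃
    have h := star_linCovIterC_eq_neg (ℓ + 1) hL2 (avgClosed_unitaryUnits (d + 1) (ℓ + 1)) le_rfl (ι.1.1 : ℕ) (retrY i U ι) hVu hα' hα3 hα4
      h52 (liftBd i (((ε : ℝ) : ℂ) • s)) hεb0 hB hBs hsmall_j hc₃_j
      (ι.1.1 : ℕ) le_rfl (zSrc i ι) ι.1.2.dir
    rw [QknitY_apply, linCovIterC_congr (ℓ + 1) hL1 (ι.1.1 : ℕ) (zSrc i ι) ι.1.2.dir (agreeOn_liftCfg_retrY i U ι) (fun _ _ _ _ => rfl),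
      star_smul, Complex.star_def, Complex.conj_ofReal, h, smul_neg]
  -- undo the scaling: `Q(U)` is `ℂ`-linear and `ε ≠ 0` is real
  funext ι
  have h := hstar ι
  rw [map_smul, Pi.smul_apply, star_smul, Complex.star_def, Complex.conj_ofReal, ← smul_neg] at h
  have hεC : ((ε : ℝ) : ℂ) ≠ 0 := Complex.ofReal_ne_zero.2 hε0.ne'
  rw [Pi.star_apply, Pi.neg_apply]
  exact smul_right_injective _ hεC h

/-! ## §2 def-Y's law shapes on the regime of record -/

/-- ★★ **(L4) FOR THE KNIT LETTER ON THE REGIME OF RECORD** `regQY G i c₀ α₀` (= the class (3.35)): `IsRealOnQ (regQY G i c₀ α₀) (QknitY i)` under the x-free numerics of §1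
(the binder list of dag-n06-c's (L7) `isBddOnQ_QknitY_reg335`). [cite: Balaban1985BackgroundPropagators, p.391, (3.12)–(3.15) p.393, (3.35) p.396; Balaban1985Averaging, Prop. 2 p.26] -/
theorem isRealOnQ_QknitY_reg335 (hGU : G ≤ unitaryUnits (Matrix (Fin N) (Fin N) ℂ)) {c₀ α₀ : ℝ} (hc : c₀ ≤ 10) (hMα : 0 ≤ (kGeo i).M * α₀)
    {α₀' : ℝ} (hα' : 0 < α₀') (hα3 : C0 (d + 1) * α₀' ≤ 1 / 3) (hα4 : 4 * α₀' ≤ c2' (d + 1) (ℓ + 1))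
    (hexp : Real.exp (4 * (800 * (((d + 1 : ℕ) : ℝ) + 1) ^ 2 * (((d + 1 : ℕ) : ℝ) + 4)) * α₀') < 2)
    (hK : Kpl i ((kGeo i).M * α₀) * (kGeo i).L ^ 4 < α₀') :
    IsRealOnQ (regQY G i c₀ α₀) (QknitY i) :=
  fun _ hU => QknitY_isRealOpY_of_reg335P i hGU hc hMα hU hα' hα3 hα4 hexp hK

/-- (L4*) for the generic adjoint `adjTrY ∘ QknitY` on the regime of record (def-Y's `IsRealOnQ.adjTrY`). [cite: Balaban1985BackgroundPropagators, p.391, (3.13) p.392] -/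
theorem isRealOnQs_adjTrY_QknitY_reg335 (hGU : G ≤ unitaryUnits (Matrix (Fin N) (Fin N) ℂ)) {c₀ α₀ : ℝ} (hc : c₀ ≤ 10) (hMα : 0 ≤ (kGeo i).M * α₀)
    {α₀' : ℝ} (hα' : 0 < α₀') (hα3 : C0 (d + 1) * α₀' ≤ 1 / 3) (hα4 : 4 * α₀' ≤ c2' (d + 1) (ℓ + 1))
    (hexp : Real.exp (4 * (800 * (((d + 1 : ℕ) : ℝ) + 1) ^ 2 * (((d + 1 : ℕ) : ℝ) + 4)) * α₀') < 2)
    (hK : Kpl i ((kGeo i).M * α₀) * (kGeo i).L ^ 4 < α₀') :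
    IsRealOnQs (regQY G i c₀ α₀) fun U => adjTrY (QknitY i U) :=
  (isRealOnQ_QknitY_reg335 i hGU hc hMα hα' hα3 hα4 hexp hK).adjTrY

/-- ★ **(L6) FOR THE KNIT LETTER ON THE REGIME OF RECORD**, this lineage's `B9Eq3115KnitLetterYOnto.QknitY_surjective_of_reg335P` in def-Y's law shape:
`IsOntoOnQ (regQY G i c₀ α₀) (QknitY i)` under `0 < α₀′ ≤ α_Q(d+1,L)`, `K_pl(Mα₀)·L⁴ < α₀′`, `K(d+1,L)·α₀′ < 1`. [cite: Balaban1985BackgroundPropagators, p.420, (3.12)–(3.15) p.393, (3.35) p.396; Balaban1985Averaging, (139)–(147) pp.39–40] -/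
theorem isOntoOnQ_QknitY_reg335 (hGU : G ≤ unitaryUnits (Matrix (Fin N) (Fin N) ℂ)) {c₀ α₀ : ℝ} (hc : c₀ ≤ 10) (hMα : 0 ≤ (kGeo i).M * α₀)
    {α₀' : ℝ} (hα' : 0 < α₀') (hαQ : α₀' ≤ alphaQ (d + 1) (ℓ + 1)) (hK : Kpl i ((kGeo i).M * α₀) * (kGeo i).L ^ 4 < α₀')
    (hsmall : kCol (d + 1) (ℓ + 1) * α₀' < 1) :
    IsOntoOnQ (regQY G i c₀ α₀) (QknitY i) := by
  letI : CStarAlgebra (Matrix (Fin N) (Fin N) ℂ) := {}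
  have hG1 : ∀ u : (Matrix (Fin N) (Fin N) ℂ)ˣ, u ∈ G → ‖(u : Matrix (Fin N) (Fin N) ℂ)‖ ≤ 1 :=
    fun u hu => (B7Prop1Explicit.mem_U1.1 (unitaryUnits_le_U1 (hGU hu))).1
  exact fun U hU => QknitY_surjective_of_reg335P i hG1 hGU hc hMα hU hα' hαQ hK hsmall

/-! ## §3 ★★★ The whole law bundle for print's letter on the regime of record -/

/-- ★★★ **ALL EIGHT LAWS (L1)–(L8) OF def-Y's `QLawsY` FOR PRINT's LETTER `QknitY` ON THE REGIME OF RECORD** (the class (3.35)), with the generic adjoint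
`adjTrY ∘ QknitY` as `Q⋆`, the knit's own site transporter `parKnitY`, the universal locality domain and the size constant `K = 2`: from `G ≤ U(N)`, `c₀ ≤ 10`,
`0 ≤ Mα₀` and the x-free numerics `0 < α₀′ ≤ α_Q(d+1,L)`, `e^{3200((d+1)+1)²((d+1)+4)α₀′} < 2`, `K_pl(Mα₀)·L⁴ < α₀′`, `K(d+1,L)·α₀′ < 1`.  By name: (L1)
`isFlatQ_QknitY`, (L2) `isLocalQ_univ`, (L3) `isAdjOnQ_adjTrY`, (L4) §2, (L5) `isCovCornerQ_QknitY`, (L6) §2, (L7) dag-n06-c's `isBddOnQ_QknitY_reg335`, (L8)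
`isNullOnQ_QknitY_reg335`. [cite: Balaban1985BackgroundPropagators, (3.12)–(3.16) p.393, (3.32) p.395, (3.115) p.418, (3.123)–(3.126) p.420, (3.35) p.396; Balaban1985Averaging, (11) p.19, (15) p.19, Prop. 2 p.26] -/
theorem qLawsY_QknitY_reg335 (hGU : G ≤ unitaryUnits (Matrix (Fin N) (Fin N) ℂ)) {c₀ α₀ : ℝ} (hc : c₀ ≤ 10) (hMα : 0 ≤ (kGeo i).M * α₀)
    {α₀' : ℝ} (hα' : 0 < α₀') (hαQ : α₀' ≤ alphaQ (d + 1) (ℓ + 1))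
    (hexp : Real.exp (4 * (800 * (((d + 1 : ℕ) : ℝ) + 1) ^ 2 * (((d + 1 : ℕ) : ℝ) + 4)) * α₀') < 2)
    (hK : Kpl i ((kGeo i).M * α₀) * (kGeo i).L ^ 4 < α₀') (hsmall : kCol (d + 1) (ℓ + 1) * α₀' < 1) :
    QLawsY (regQY G i c₀ α₀) (fun _ => Set.univ) (QknitY i) (fun U => adjTrY (QknitY i U)) (parKnitY i) 2 := by
  letI : CStarAlgebra (Matrix (Fin N) (Fin N) ℂ) := {}
  have hL2 : 2 ≤ ℓ + 1 := hL.2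
  have hD : 1 ≤ d + 1 := Nat.succ_pos d
  have hG1 : ∀ u : (Matrix (Fin N) (Fin N) ℂ)ˣ, u ∈ G → ‖(u : Matrix (Fin N) (Fin N) ℂ)‖ ≤ 1 :=
    fun u hu => (B7Prop1Explicit.mem_U1.1 (unitaryUnits_le_U1 (hGU hu))).1
  obtain ⟨hα3, hα2, -⟩ := windows_of_alphaQ (D := d + 1) hL2 hD hα' hαQ
  have hα4 : 4 * α₀' ≤ c2' (d + 1) (ℓ + 1) := by have := four_mul_alphaQ_le (d + 1) (ℓ + 1); linarith
  exact { flat := isFlatQ_QknitY i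
          isLocal := isLocalQ_univ (QknitY i)
          cov := isCovCornerQ_QknitY i
          adj := isAdjOnQ_adjTrY (regQY G i c₀ α₀) (QknitY i)
          real := isRealOnQ_QknitY_reg335 i hGU hc hMα hα' hα3 hα4 hexp hK
          onto := isOntoOnQ_QknitY_reg335 i hGU hc hMα hα' hαQ hK hsmall
          bdd := isBddOnQ_QknitY_reg335 i hGU hc hMα hα' hα3 hα4 hexp hK
          null := isNullOnQ_QknitY_reg335 i hG1 hGU hc hMα hα' hα3 hα2 hK }

/-- the same bundle at def-Y's knit family of record `qKnitOfRecord N θ i` (`= QknitY i` by `qKnitOfRecord_apply`, `rfl`), adjoint `qsOfQFamY`-free form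
`fun U ↦ adjTrY (qKnitOfRecord N θ i U)`. [cite: Balaban1985BackgroundPropagators, (3.12)–(3.16) p.393, (3.115) p.418, (3.35) p.396] -/
theorem qLawsY_qKnitOfRecord {θ : Stage3Params} {G : Subgroup (Matrix (Fin N) (Fin N) ℂ)ˣ} (hGU : G ≤ unitaryUnits (Matrix (Fin N) (Fin N) ℂ))
    {c₀ α₀ : ℝ} (hc : c₀ ≤ 10) (i : KIdx θ.d₆ θ.ℓ₆ θ.hd' θ.hL' θ.b₀ θ.b₁) (hMα : 0 ≤ (kGeo i).M * α₀)
    {α₀' : ℝ} (hα' : 0 < α₀') (hαQ : α₀' ≤ alphaQ (θ.d₆ + 1) (θ.ℓ₆ + 1))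
    (hexp : Real.exp (4 * (800 * (((θ.d₆ + 1 : ℕ) : ℝ) + 1) ^ 2 * (((θ.d₆ + 1 : ℕ) : ℝ) + 4)) * α₀') < 2)
    (hK : Kpl i ((kGeo i).M * α₀) * (kGeo i).L ^ 4 < α₀') (hsmall : kCol (θ.d₆ + 1) (θ.ℓ₆ + 1) * α₀' < 1) :
    QLawsY (regQY G i c₀ α₀) (fun _ => Set.univ) (qKnitOfRecord N θ i) (fun U => adjTrY (qKnitOfRecord N θ i U)) (parKnitY i) 2 :=
  qLawsY_QknitY_reg335 i hGU hc hMα hα' hαQ hexp hK hsmall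

end Literature.MathematicalPhysics.QuantumFieldTheory.Balaban1983to89.B9Eq3115KnitLetterYRealReg335

end
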